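import Summits.HubbardSuperconductivity.HubbardSuperconductivity.Theorems.KLProgrammeKLRegimeFlowReadScaleZeroSunsetCertRowsThreeShells
import Summits.HubbardSuperconductivity.HubbardSuperconductivity.Theorems.KLProgrammeKLRegimeFlowReadScaleZeroSunsetCertRowsRecordsFarSup

/-!
# Route `KLProgramme`, crux K3 — engine-flow child (stmt-HubbardSuperconductivity-20437), stub (C) at `n = 0`, located item #22a «(C)-SCALE0-PT2»:
# THE CERTIFIED SUNSET ROWS, THREE-SHELLS FORM — at the engine thresholds with the far-sup certificate, and THE RECORD-LEVEL ONE-CALL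

Seat hubbard-kl-k3c5-p1 (g18; owner of #22a).  Companion of `…SunsetCertRowsThreeShells` (§0–§2): the line-by-line twins of p1 g22's
`…SunsetCertRowsFarSup.sunsetRows_of_certV3_farSup` (§3 there) and of k3c5 g15's `…SunsetCertRowsRecordsFarSup.sunsetRows_of_records_farSup` with the low shell
split at `ω₀`:
* §1 `farBudget3_le_rational_farSup` — the far budget's real-analysis part majorised by rationals (twin of `farBudget_le_rational_farSup`):
  `(Sfar + 10⁻²⁹)·(high_k + (ω₀(√Gl_k + 10⁻¹⁰)² + ω₁(√Gm_k + 10⁻¹⁰)²)) ≤ (Sfar + 10⁻²⁹)·(2·10⁻⁸ + (ω₀(t_k + 10⁻¹⁰)² + ω₁(v_k + 10⁻¹⁰)²))`;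
* §2 **`sunsetRows_of_certV3_farSup3`** — `hS0`/`hSk` of `twoLegRead_frameZero_of_sunsetData` at `β ≥ klBetaMin`, `0 < U ≤ 2⁻²⁰`, `L ≥ klEngL₃`, `M ≥ klEngM₃`
  from the near certificate, the far-sup certificate, and TWO PAIRS of Parseval gaps: `(G₀lo, G₂lo)` at the window frequencies `|ω_i| < ω₀`, `(G₀mid, G₂mid)` at
  `ω₀ ≤ |ω_i| < ω₁`;
* §3 **`sunsetRows_of_records3_farSup`** — THE RECORD-LEVEL ONE-CALL of the two-low-shell format ((R361)(1)): near record `c` + `ScaleZeroSunsetCertV3 c`, the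
  INNER far-gap record `rlo` with the standard certificate `ScaleZeroFarGapCert c rlo` (its crossover `rlo.ω₁` IS `ω₀`; design `1/32`), the OUTER far-gap record `rmid`
  with its certificate stated INLINE on the shell `rlo.ω₁ ≤ |ω| < rmid.ω₁` (the Prop `ScaleZeroFarGapCert` quantifies over all `|ω| < ω₁` and cannot carry the smaller
  outer-shell gaps; no new definition is introduced), the far-sup record `rs` + `ScaleZeroFarSupCert c rs`, the regime, closed rational side conditions
  (`0 < rlo.ω₁`, `1/32 ≤ rmid.ω₁ ≤ 1/4`, `255 ≤ rmid.ω₁(Rc+1)`, majorants `s` of `rlo.G`, `u` of `rmid.G`, …) and the budget row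
  `row k + (Sfar + 10⁻²⁹)·(2·10⁻⁸ + (rlo.ω₁(t_k + 10⁻¹⁰)² + rmid.ω₁(v_k + 10⁻¹⁰)²)) ≤ bS k` — every one `norm_num` on literals.
SIZES [float / est., labelled]: at Rc = 1024, `Sfar = 3.535·10⁻⁵`, ω₀ = 1/32, ω₁ = 1/4: far row₂ ≈ 3.5·10⁻⁵·(2·10⁴/32 + G₂mid/4) ≈ 0.022 + 8.8·10⁻⁶·G₂mid vs 0.177 one-shell
((R414)(B)); `G₂mid` (pure resolvent shell, `W ≡ 1`) is est. ≲ 10³ by an order-4 sup-Sobolev tail and is the natural kit-free target.  No definitions; the certificates are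
HYPOTHESES (W4 near records and B′ UNRUN, B″ booked); nothing here asserts (C), any stub of 20437, K3, the margin or superconductivity.
References: BGM 2006 §2.3 (2.17)–(2.20), §3 (3.2) [cite: BenfattoGiulianiMastropietro2006].
-/

noncomputable section

namespace Summit.HubbardSuperconductivity.HubbardSuperconductivity.Theorems.KLRegimeSplit

set_option linter.dupNamespace false -- summit = problem name (single-conjunct summit), D-0017

open Literature.MathematicalPhysics.QuantumLattice Literature.Probability.LatticeModels Literature.Analysis.FunctionSpaces
open Summit.HubbardSuperconductivity.HubbardSuperconductivity.Theorems.DispersionFlow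
open Summit.HubbardSuperconductivity.HubbardSuperconductivity.Theorems.EngineV8
open MeasureTheory Set Finset Complex UnitAddTorus Real GrassmannAlgebra Matrix
open scoped FourierTransform Nat ENNReal NNReal

variable {L M : ℕ} [NeZero L]

/-! ## §1 The three-shells far budget majorised by rationals -/

/-- **The far budget with the far-SUP constant, two low shells**: for `klE0 ≤ ω₁ ≤ 1/4`, `255 ≤ ω₁(Rc+1)`, `0 ≤ ω₀`, `0 ≤ S`, and square-root majorants
`Gl₀ ≤ s₀²`, `0 ≤ Gl₂ ≤ s₂²`, `Gm₀ ≤ u₀²`, `0 ≤ Gm₂ ≤ u₂²` (`s, u ≥ 0`):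
`S·(2ᵏ·2500·C(ω₁,Rc,k)/ω₁ + (ω₀(√Gl_k + 10⁻¹⁰)² + ω₁(√Gm_k + 10⁻¹⁰)²)) ≤ S·(2·10⁻⁸ + (ω₀(t_k + 10⁻¹⁰)² + ω₁(v_k + 10⁻¹⁰)²))`,
`t = (s₀,(s₀+s₂)/2,s₂)`, `v = (u₀,(u₀+u₂)/2,u₂)` (twin of `farBudget_le_rational_farSup`). [cite: BenfattoGiulianiMastropietro2006, §2.3 (2.17)-(2.20)] -/
theorem farBudget3_le_rational_farSup {ω₀ ω₁ : ℝ} (hω₁ : klE0 ≤ ω₁) (hω₁' : ω₁ ≤ 1 / 4) {Rc : ℕ} (hRc : 255 ≤ ω₁ * ((Rc : ℝ) + 1))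
    (hω₀ : 0 ≤ ω₀)
    {Gl₀ Gl₂ s₀ s₂ : ℝ} (hG₂ : 0 ≤ Gl₂) (hs₀ : Gl₀ ≤ s₀ ^ 2) (hs₂ : Gl₂ ≤ s₂ ^ 2) (hs₀0 : 0 ≤ s₀) (hs₂0 : 0 ≤ s₂)
    {Gm₀ Gm₂ u₀ u₂ : ℝ} (hGm₂ : 0 ≤ Gm₂) (hu₀ : Gm₀ ≤ u₀ ^ 2) (hu₂ : Gm₂ ≤ u₂ ^ 2) (hu₀0 : 0 ≤ u₀) (hu₂0 : 0 ≤ u₂)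
    {S : ℝ} (hS : 0 ≤ S) (k : Fin 3) :
    S * (2 ^ (k : ℕ) * 2500 *
          ((max 1 ((2 * (k : ℕ) : ℝ) / Real.arsinh (ω₁ / 4))) ^ (k : ℕ) * Real.exp (-(Real.arsinh (ω₁ / 4) * (Rc + 1))) *
            (1 + 2 * (1 - Real.exp (-(Real.arsinh (ω₁ / 4) / 4)))⁻¹) ^ 2) / ω₁ +
          (ω₀ * (Real.sqrt (![Gl₀, Real.sqrt (Gl₀ * Gl₂), Gl₂] k) + (10 : ℝ)⁻¹ ^ 10) ^ 2 +
            ω₁ * (Real.sqrt (![Gm₀, Real.sqrt (Gm₀ * Gm₂), Gm₂] k) + (10 : ℝ)⁻¹ ^ 10) ^ 2)) ≤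
      S * (2 * (10 : ℝ)⁻¹ ^ 8 + (ω₀ * (![s₀, (s₀ + s₂) / 2, s₂] k + (10 : ℝ)⁻¹ ^ 10) ^ 2 +
        ω₁ * (![u₀, (u₀ + u₂) / 2, u₂] k + (10 : ℝ)⁻¹ ^ 10) ^ 2)) := by
  have hE0 : (1 : ℝ) / 32 ≤ ω₁ := by have : klE0 = 1 / 32 := rfl; rw [← this]; exact hω₁
  have hω1 : 0 ≤ ω₁ := by linarith
  have hH := highShell_budget_le hω₁ hω₁' hRc k
  have ht := sqrt_gapVec_le hG₂ hs₀ hs₂ hs₀0 hs₂0 k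
  have hv := sqrt_gapVec_le hGm₂ hu₀ hu₂ hu₀0 hu₂0 k
  refine mul_le_mul_of_nonneg_left (add_le_add hH (add_le_add (mul_le_mul_of_nonneg_left ?_ hω₀) (mul_le_mul_of_nonneg_left ?_ hω1))) hS
  · exact pow_le_pow_left₀ (by positivity) (by linarith [ht]) 2
  · exact pow_le_pow_left₀ (by positivity) (by linarith [hv]) 2

/-! ## §2 At the engine thresholds, the far sup from `ScaleZeroFarSupCert`, two low shells -/

/-- **THE CERTIFIED SUNSET ROWS AT THE ENGINE THRESHOLDS WITH THE FAR-SUP CERTIFICATE, THREE SHELLS** (twin of `sunsetRows_of_certV3_farSup`; `Sf := Sfar + 10⁻²⁹`). [cite: BenfattoGiulianiMastropietro2006, §2.3 (2.17)-(2.20)] -/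
theorem sunsetRows_of_certV3_farSup3 [NeZero M] (c : SunsetCellRecordV3) (hc : ScaleZeroSunsetCertV3 c)
    {μ β U : ℝ} (hμ : μ ∈ klWindowC) (hμlo : (c.μlo : ℝ) ≤ μ) (hμhi : μ ≤ c.μhi)
    (hβ : klBetaMin ≤ β) (hU0 : 0 < U) (hU : U ≤ (2 : ℝ)⁻¹ ^ 20) (hL3 : klEngL₃ β U ≤ L) (hM3 : klEngM₃ β U L ≤ M)
    (hRcL : 4 * c.Rc + 2 ≤ L) (hTmax : (10 : ℝ)⁻¹ ^ 30 ≤ (c.Tmax : ℝ))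
    (hrow : ∀ k : Fin 3, 0 ≤ (c.row k : ℝ))
    {ω₀ ω₁ : ℝ} (hω₀ : 0 < ω₀) (hω₁ : klE0 ≤ ω₁)
    (r : SunsetFarSupRecord) (hr : ScaleZeroFarSupCert c.toSunsetCellRecordV2 r) (hSfar : 0 ≤ (r.Sfar : ℝ))
    {G₀lo G₂lo G₀mid G₂mid : ℝ}
    (hgap0lo : ∀ i : MatsubaraIdx M, |matsubaraFreq β M i| < ω₀ →
      (∫ y in Torus.unitCube (Fin 2), ‖(fun y : Momentum => uvSymbolFn 1 klE0 (frameLevel μ 0 ((2 * π) • y)) (matsubaraFreq β M i)) y‖ ^ 2) -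
        ∑ z ∈ insert (0 : Site 2) c.disk, ‖mFourierCoeff (Torus.descend
          (fun y : Momentum => uvSymbolFn 1 klE0 (frameLevel μ 0 ((2 * π) • y)) (matsubaraFreq β M i))
          (uvSpatialSymbol_isLatticePeriodic 1 klE0 μ 0 (matsubaraFreq β M i))) (-z)‖ ^ 2 ≤ G₀lo)
    (hgap2lo : ∀ i : MatsubaraIdx M, |matsubaraFreq β M i| < ω₀ →
      (2 * π) ^ (-(2 : ℤ)) *
        ((∫ y in Torus.unitCube (Fin 2), ‖fderiv ℝ (fun y : Momentum => uvSymbolFn 1 klE0 (frameLevel μ 0 ((2 * π) • y)) (matsubaraFreq β M i)) y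
            (EuclideanSpace.single 0 (1 : ℝ))‖ ^ 2) +
          ∫ y in Torus.unitCube (Fin 2), ‖fderiv ℝ (fun y : Momentum => uvSymbolFn 1 klE0 (frameLevel μ 0 ((2 * π) • y)) (matsubaraFreq β M i)) y
            (EuclideanSpace.single 1 (1 : ℝ))‖ ^ 2) -
        ∑ z ∈ insert (0 : Site 2) c.disk, ((((z 0 : ℤ) : ℝ)) ^ 2 + (((z 1 : ℤ) : ℝ)) ^ 2) *
          ‖mFourierCoeff (Torus.descend (fun y : Momentum => uvSymbolFn 1 klE0 (frameLevel μ 0 ((2 * π) • y)) (matsubaraFreq β M i))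
            (uvSpatialSymbol_isLatticePeriodic 1 klE0 μ 0 (matsubaraFreq β M i))) (-z)‖ ^ 2 ≤ G₂lo)
    (hgap0mid : ∀ i : MatsubaraIdx M, ω₀ ≤ |matsubaraFreq β M i| → |matsubaraFreq β M i| < ω₁ →
      (∫ y in Torus.unitCube (Fin 2), ‖(fun y : Momentum => uvSymbolFn 1 klE0 (frameLevel μ 0 ((2 * π) • y)) (matsubaraFreq β M i)) y‖ ^ 2) -
        ∑ z ∈ insert (0 : Site 2) c.disk, ‖mFourierCoeff (Torus.descend
          (fun y : Momentum => uvSymbolFn 1 klE0 (frameLevel μ 0 ((2 * π) • y)) (matsubaraFreq β M i))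
          (uvSpatialSymbol_isLatticePeriodic 1 klE0 μ 0 (matsubaraFreq β M i))) (-z)‖ ^ 2 ≤ G₀mid)
    (hgap2mid : ∀ i : MatsubaraIdx M, ω₀ ≤ |matsubaraFreq β M i| → |matsubaraFreq β M i| < ω₁ →
      (2 * π) ^ (-(2 : ℤ)) *
        ((∫ y in Torus.unitCube (Fin 2), ‖fderiv ℝ (fun y : Momentum => uvSymbolFn 1 klE0 (frameLevel μ 0 ((2 * π) • y)) (matsubaraFreq β M i)) y
            (EuclideanSpace.single 0 (1 : ℝ))‖ ^ 2) +
          ∫ y in Torus.unitCube (Fin 2), ‖fderiv ℝ (fun y : Momentum => uvSymbolFn 1 klE0 (frameLevel μ 0 ((2 * π) • y)) (matsubaraFreq β M i)) y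
            (EuclideanSpace.single 1 (1 : ℝ))‖ ^ 2) -
        ∑ z ∈ insert (0 : Site 2) c.disk, ((((z 0 : ℤ) : ℝ)) ^ 2 + (((z 1 : ℤ) : ℝ)) ^ 2) *
          ‖mFourierCoeff (Torus.descend (fun y : Momentum => uvSymbolFn 1 klE0 (frameLevel μ 0 ((2 * π) • y)) (matsubaraFreq β M i))
            (uvSpatialSymbol_isLatticePeriodic 1 klE0 μ 0 (matsubaraFreq β M i))) (-z)‖ ^ 2 ≤ G₂mid)
    {bS : ℕ → ℝ}
    (hbS : ∀ k : Fin 3, (c.row k : ℝ) +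
      ((r.Sfar : ℝ) + (10 : ℝ)⁻¹ ^ 29) *
        (2 ^ (k : ℕ) * 2500 *
          ((max 1 ((2 * (k : ℕ) : ℝ) / Real.arsinh (ω₁ / 4))) ^ (k : ℕ) * Real.exp (-(Real.arsinh (ω₁ / 4) * (c.Rc + 1))) *
            (1 + 2 * (1 - Real.exp (-(Real.arsinh (ω₁ / 4) / 4)))⁻¹) ^ 2) / ω₁ +
          (ω₀ * (Real.sqrt (![G₀lo, Real.sqrt (G₀lo * G₂lo), G₂lo] k) + (10 : ℝ)⁻¹ ^ 10) ^ 2 +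
            ω₁ * (Real.sqrt (![G₀mid, Real.sqrt (G₀mid * G₂mid), G₂mid] k) + (10 : ℝ)⁻¹ ^ 10) ^ 2)) ≤ bS k) :
    (∀ (σ : Fin 2) (p₀ : GridPoint L (2 * (2 * M))), ∑ p₁ : GridPoint L (2 * (2 * M)),
      (if p₁ = p₀ then (0 : ℝ) else (if p₁.2 - p₀.2 = 0 then (0 : ℝ) else 1) * ‖contr ℂ ((hubbardGridSub L M β (2 * (2 * M))).transpose * hubbardCovAboveCT L M β μ 0 0 klE0 *
                hubbardGridSub L M β (2 * (2 * M))) (((p₁, σ), 0) : GridLeg (GridPoint L (2 * (2 * M)))) ((p₀, σ), 1) *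
              (contr ℂ ((hubbardGridSub L M β (2 * (2 * M))).transpose * hubbardCovAboveCT L M β μ 0 0 klE0 *
                hubbardGridSub L M β (2 * (2 * M))) (((p₀, σ.rev), 0) : GridLeg (GridPoint L (2 * (2 * M)))) ((p₁, σ.rev), 1) *
                contr ℂ ((hubbardGridSub L M β (2 * (2 * M))).transpose * hubbardCovAboveCT L M β μ 0 0 klE0 *
                hubbardGridSub L M β (2 * (2 * M))) (((p₁, σ.rev), 0) : GridLeg (GridPoint L (2 * (2 * M)))) ((p₀, σ.rev), 1))‖) ≤ bS 0 * (((2 * (2 * M) : ℕ) : ℝ) / β)) ∧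
    (∀ k, 1 ≤ k → k ≤ 2 → ∀ (σ : Fin 2) (p₀ : GridPoint L (2 * (2 * M))), ∑ p₁ : GridPoint L (2 * (2 * M)),
      (if p₁ = p₀ then (0 : ℝ) else
        Real.sqrt ((((p₁.2 - p₀.2) 0).valMinAbs.natAbs : ℝ) ^ 2 + (((p₁.2 - p₀.2) 1).valMinAbs.natAbs : ℝ) ^ 2) ^ k * ‖contr ℂ ((hubbardGridSub L M β (2 * (2 * M))).transpose * hubbardCovAboveCT L M β μ 0 0 klE0 *
                hubbardGridSub L M β (2 * (2 * M))) (((p₁, σ), 0) : GridLeg (GridPoint L (2 * (2 * M)))) ((p₀, σ), 1) *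
              (contr ℂ ((hubbardGridSub L M β (2 * (2 * M))).transpose * hubbardCovAboveCT L M β μ 0 0 klE0 *
                hubbardGridSub L M β (2 * (2 * M))) (((p₀, σ.rev), 0) : GridLeg (GridPoint L (2 * (2 * M)))) ((p₁, σ.rev), 1) *
                contr ℂ ((hubbardGridSub L M β (2 * (2 * M))).transpose * hubbardCovAboveCT L M β μ 0 0 klE0 *
                hubbardGridSub L M β (2 * (2 * M))) (((p₁, σ.rev), 0) : GridLeg (GridPoint L (2 * (2 * M)))) ((p₀, σ.rev), 1))‖) ≤
        bS k * (((2 * (2 * M) : ℕ) : ℝ) / β)) := by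
  have hβ₀ : klBetaMin = 128 := rfl
  have hβ128 : (128 : ℝ) ≤ β := by rw [← hβ₀]; exact hβ
  have hβpos : 0 < β := by linarith
  have hLpos : (0 : ℝ) < L := by
    have h := (klEngL₃_ge_of_le hβ hU0 hU).trans hL3
    have h' : 0 < L := lt_of_lt_of_le (by norm_num) h
    exact_mod_cast h'
  -- `β/4M ≤ 2⁻¹⁰` from `M ≥ klEngM₃ ≥ 2¹⁰β²L² ≥ 2¹⁰·β`
  have hδ : β / ((2 * (2 * M) : ℕ) : ℝ) ≤ (2 : ℝ)⁻¹ ^ 10 := by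
    have hM' : ((klEngM₃ β U L : ℕ) : ℝ) ≤ M := by exact_mod_cast hM3
    have hMge : (2 : ℝ) ^ 10 * β ≤ M := by
      refine le_trans ?_ hM'
      unfold klEngM₃
      push_cast
      have hceil : β ≤ (⌈|β|⌉₊ : ℝ) := by rw [abs_of_pos hβpos]; exact Nat.le_ceil β
      have h1 : β ≤ ((⌈|β|⌉₊ : ℝ) + 1) ^ 2 := by nlinarith
      have h2 : (1 : ℝ) ≤ ((L : ℝ) + 1) ^ 2 := by nlinarith
      calc (2 : ℝ) ^ 10 * β = 2 ^ 10 * β * 1 := by ring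
        _ ≤ 2 ^ 10 * ((⌈|β|⌉₊ : ℝ) + 1) ^ 2 * ((L : ℝ) + 1) ^ 2 := mul_le_mul (mul_le_mul_of_nonneg_left h1 (by positivity)) h2 (by positivity) (by positivity)
        _ = _ := by norm_num
    have hMpos : (0 : ℝ) < M := lt_of_lt_of_le (by positivity) hMge
    have hN : ((2 * (2 * M) : ℕ) : ℝ) = 4 * M := by push_cast; ring
    rw [hN, div_le_iff₀ (by positivity)]
    nlinarith
  obtain ⟨hR, -⟩ := sunsetTail_R_of_le hRcL
  have hT := sunsetTail_hT_of_klEng (L := L) (M := M) (Rc := c.Rc) hμ hβ hU0 hU hL3 hM3 hRcL hTmax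
  have hS0 : 0 ≤ (r.Sfar : ℝ) + (10 : ℝ)⁻¹ ^ 29 := by positivity
  have hA2 : ∀ (σ : Fin 2) (p₀ : GridPoint L (2 * (2 * M))) (x : TorusSite 2 L),
      (x ≠ p₀.2 ∧ (fun j => ((x - p₀.2) j).valMinAbs : Site 2) ∉ c.disk) → ∀ j₁ : Fin (2 * (2 * M)),
        ‖((hubbardGridSub L M β (2 * (2 * M))).transpose * hubbardCovAboveCT L M β μ 0 0 klE0 * hubbardGridSub L M β (2 * (2 * M)))
            (((p₀, σ), 0) : GridLeg (GridPoint L (2 * (2 * M)))) ((((j₁, x) : GridPoint L (2 * (2 * M))), σ), 1)‖ ≤ (r.Sfar : ℝ) + (10 : ℝ)⁻¹ ^ 29 :=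
    fun σ p₀ x hx j₁ => norm_gridCov_far_le_of_farSupCert (L := L) (M := M) c.toSunsetCellRecordV2 r hr hSfar hμlo hμhi hμ hβ hU0 hU hL3 hM3 σ p₀ x hx j₁
  exact sunsetRows_of_certV3_plancherelGaps3_farSup (L := L) c hc hμlo hμhi hβ hU0 hU hL3 hδ (N' := 12) (R := L - 1 - 2 * c.Rc) (by norm_num) hR hT hrow hω₀ hω₁
    hgap0lo hgap2lo hgap0mid hgap2mid hS0 hA2 hbS

/-! ## §3 The record-level one-call, two-low-shell format -/

/-- **THE CERTIFIED SUNSET ROWS FROM THE FOUR RECORDS (near, inner far-gap, outer far-gap, far-sup)** — twin of `sunsetRows_of_records_farSup` in the two-low-shell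
format of (R361)(1); every side condition a closed rational inequality on record fields or emitted square-root majorants; the regime hypotheses are the engine's.
[cite: BenfattoGiulianiMastropietro2006, §2.3 (2.17)-(2.20)] -/
theorem sunsetRows_of_records3_farSup [NeZero M] (c : SunsetCellRecordV3) (hc : ScaleZeroSunsetCertV3 c)
    (rlo : SunsetFarGapRecord) (hrlo : ScaleZeroFarGapCert c.toSunsetCellRecordV2 rlo)
    (rmid : SunsetFarGapRecord)
    (hrmid :
      ∀ μ : ℝ, (c.μlo : ℝ) ≤ μ → μ ≤ c.μhi → ∀ om : ℝ, om ≠ 0 → (rlo.ω₁ : ℝ) ≤ |om| → |om| < rmid.ω₁ →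
        ((∫ y in Torus.unitCube (Fin 2), ‖(fun y : Momentum => uvSymbolFn 1 klE0 (frameLevel μ 0 ((2 * π) • y)) om) y‖ ^ 2) -
            ∑ z ∈ insert (0 : Site 2) c.disk, ‖mFourierCoeff (Torus.descend
              (fun y : Momentum => uvSymbolFn 1 klE0 (frameLevel μ 0 ((2 * π) • y)) om) (uvSpatialSymbol_isLatticePeriodic 1 klE0 μ 0 om)) (-z)‖ ^ 2 ≤ rmid.G₀) ∧
        ((2 * π) ^ (-(2 : ℤ)) *
            ((∫ y in Torus.unitCube (Fin 2), ‖fderiv ℝ (fun y : Momentum => uvSymbolFn 1 klE0 (frameLevel μ 0 ((2 * π) • y)) om) y (EuclideanSpace.single 0 (1 : ℝ))‖ ^ 2) +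
              ∫ y in Torus.unitCube (Fin 2), ‖fderiv ℝ (fun y : Momentum => uvSymbolFn 1 klE0 (frameLevel μ 0 ((2 * π) • y)) om) y (EuclideanSpace.single 1 (1 : ℝ))‖ ^ 2) -
            ∑ z ∈ insert (0 : Site 2) c.disk, ((((z 0 : ℤ) : ℝ)) ^ 2 + (((z 1 : ℤ) : ℝ)) ^ 2) *
              ‖mFourierCoeff (Torus.descend (fun y : Momentum => uvSymbolFn 1 klE0 (frameLevel μ 0 ((2 * π) • y)) om)
                (uvSpatialSymbol_isLatticePeriodic 1 klE0 μ 0 om)) (-z)‖ ^ 2 ≤ rmid.G₂))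
    (rs : SunsetFarSupRecord) (hrs : ScaleZeroFarSupCert c.toSunsetCellRecordV2 rs)
    {μ β U : ℝ} (hμ : μ ∈ klWindowC) (hμlo : (c.μlo : ℝ) ≤ μ) (hμhi : μ ≤ c.μhi)
    (hβ : klBetaMin ≤ β) (hU0 : 0 < U) (hU : U ≤ (2 : ℝ)⁻¹ ^ 20) (hL3 : klEngL₃ β U ≤ L) (hM3 : klEngM₃ β U L ≤ M)
    -- rational side conditions on the near record
    (hRc' : 4 * c.Rc + 2 ≤ 2 ^ 10 * 129 ^ 2 * (2 ^ 20 + 1) ^ 2)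
    (hTmax : (10 : ℚ)⁻¹ ^ 30 ≤ c.Tmax) (hrow : ∀ k : Fin 3, 0 ≤ c.row k)
    -- rational side conditions on the far records and the square-root majorants
    (hω₀ : 0 < rlo.ω₁) (hω₁ : (1 : ℚ) / 32 ≤ rmid.ω₁) (hω₁' : rmid.ω₁ ≤ 1 / 4) (hωRc : 255 ≤ rmid.ω₁ * ((c.Rc : ℚ) + 1))
    (hG₂lo : 0 ≤ rlo.G₂) (hG₂mid : 0 ≤ rmid.G₂)
    {s₀ s₂ : ℚ} (hs₀ : rlo.G₀ ≤ s₀ ^ 2) (hs₂ : rlo.G₂ ≤ s₂ ^ 2) (hs₀0 : 0 ≤ s₀) (hs₂0 : 0 ≤ s₂)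
    {u₀ u₂ : ℚ} (hu₀ : rmid.G₀ ≤ u₀ ^ 2) (hu₂ : rmid.G₂ ≤ u₂ ^ 2) (hu₀0 : 0 ≤ u₀) (hu₂0 : 0 ≤ u₂) (hSfar : 0 ≤ rs.Sfar)
    -- the budget row
    {bS : ℕ → ℝ}
    (hbS : ∀ k : Fin 3, (c.row k : ℝ) +
      ((rs.Sfar : ℝ) + (10 : ℝ)⁻¹ ^ 29) *
        (2 * (10 : ℝ)⁻¹ ^ 8 + ((rlo.ω₁ : ℝ) * (![(s₀ : ℝ), ((s₀ : ℝ) + s₂) / 2, (s₂ : ℝ)] k + (10 : ℝ)⁻¹ ^ 10) ^ 2 +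
          (rmid.ω₁ : ℝ) * (![(u₀ : ℝ), ((u₀ : ℝ) + u₂) / 2, (u₂ : ℝ)] k + (10 : ℝ)⁻¹ ^ 10) ^ 2)) ≤ bS k) :
    (∀ (σ : Fin 2) (p₀ : GridPoint L (2 * (2 * M))), ∑ p₁ : GridPoint L (2 * (2 * M)),
      (if p₁ = p₀ then (0 : ℝ) else (if p₁.2 - p₀.2 = 0 then (0 : ℝ) else 1) * ‖contr ℂ ((hubbardGridSub L M β (2 * (2 * M))).transpose * hubbardCovAboveCT L M β μ 0 0 klE0 *
                hubbardGridSub L M β (2 * (2 * M))) (((p₁, σ), 0) : GridLeg (GridPoint L (2 * (2 * M)))) ((p₀, σ), 1) *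
              (contr ℂ ((hubbardGridSub L M β (2 * (2 * M))).transpose * hubbardCovAboveCT L M β μ 0 0 klE0 *
                hubbardGridSub L M β (2 * (2 * M))) (((p₀, σ.rev), 0) : GridLeg (GridPoint L (2 * (2 * M)))) ((p₁, σ.rev), 1) *
                contr ℂ ((hubbardGridSub L M β (2 * (2 * M))).transpose * hubbardCovAboveCT L M β μ 0 0 klE0 *
                hubbardGridSub L M β (2 * (2 * M))) (((p₁, σ.rev), 0) : GridLeg (GridPoint L (2 * (2 * M)))) ((p₀, σ.rev), 1))‖) ≤ bS 0 * (((2 * (2 * M) : ℕ) : ℝ) / β)) ∧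
    (∀ k, 1 ≤ k → k ≤ 2 → ∀ (σ : Fin 2) (p₀ : GridPoint L (2 * (2 * M))), ∑ p₁ : GridPoint L (2 * (2 * M)),
      (if p₁ = p₀ then (0 : ℝ) else
        Real.sqrt ((((p₁.2 - p₀.2) 0).valMinAbs.natAbs : ℝ) ^ 2 + (((p₁.2 - p₀.2) 1).valMinAbs.natAbs : ℝ) ^ 2) ^ k * ‖contr ℂ ((hubbardGridSub L M β (2 * (2 * M))).transpose * hubbardCovAboveCT L M β μ 0 0 klE0 *
                hubbardGridSub L M β (2 * (2 * M))) (((p₁, σ), 0) : GridLeg (GridPoint L (2 * (2 * M)))) ((p₀, σ), 1) *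
              (contr ℂ ((hubbardGridSub L M β (2 * (2 * M))).transpose * hubbardCovAboveCT L M β μ 0 0 klE0 *
                hubbardGridSub L M β (2 * (2 * M))) (((p₀, σ.rev), 0) : GridLeg (GridPoint L (2 * (2 * M)))) ((p₁, σ.rev), 1) *
                contr ℂ ((hubbardGridSub L M β (2 * (2 * M))).transpose * hubbardCovAboveCT L M β μ 0 0 klE0 *
                hubbardGridSub L M β (2 * (2 * M))) (((p₁, σ.rev), 0) : GridLeg (GridPoint L (2 * (2 * M)))) ((p₀, σ.rev), 1))‖) ≤
        bS k * (((2 * (2 * M) : ℕ) : ℝ) / β)) := by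
  have hβ₀ : klBetaMin = 128 := rfl
  have hβpos : 0 < β := by rw [hβ₀] at hβ; linarith
  have hRcL : 4 * c.Rc + 2 ≤ L := le_trans hRc' ((klEngL₃_ge_of_le hβ hU0 hU).trans hL3)
  have hTmax' : (10 : ℝ)⁻¹ ^ 30 ≤ (c.Tmax : ℝ) := by
    have h := (Rat.cast_le (K := ℝ)).2 hTmax
    push_cast at h
    exact h
  have hrow' : ∀ k : Fin 3, 0 ≤ (c.row k : ℝ) := fun k => by exact_mod_cast hrow k
  have hω₀r : (0 : ℝ) < (rlo.ω₁ : ℝ) := by exact_mod_cast hω₀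
  have hω₁r : klE0 ≤ (rmid.ω₁ : ℝ) := by
    have e : klE0 = 1 / 32 := rfl
    have h := (Rat.cast_le (K := ℝ)).2 hω₁
    push_cast at h
    rw [e]; exact h
  have hω₁r' : (rmid.ω₁ : ℝ) ≤ 1 / 4 := by
    have h := (Rat.cast_le (K := ℝ)).2 hω₁'
    push_cast at h
    exact h
  have hωRcr : (255 : ℝ) ≤ (rmid.ω₁ : ℝ) * ((c.Rc : ℝ) + 1) := by exact_mod_cast hωRc
  have hG₂lor : (0 : ℝ) ≤ (rlo.G₂ : ℝ) := by exact_mod_cast hG₂lo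
  have hG₂midr : (0 : ℝ) ≤ (rmid.G₂ : ℝ) := by exact_mod_cast hG₂mid
  have hs₀r : (rlo.G₀ : ℝ) ≤ (s₀ : ℝ) ^ 2 := by exact_mod_cast hs₀
  have hs₂r : (rlo.G₂ : ℝ) ≤ (s₂ : ℝ) ^ 2 := by exact_mod_cast hs₂
  have hs₀0r : (0 : ℝ) ≤ (s₀ : ℝ) := by exact_mod_cast hs₀0
  have hs₂0r : (0 : ℝ) ≤ (s₂ : ℝ) := by exact_mod_cast hs₂0
  have hu₀r : (rmid.G₀ : ℝ) ≤ (u₀ : ℝ) ^ 2 := by exact_mod_cast hu₀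
  have hu₂r : (rmid.G₂ : ℝ) ≤ (u₂ : ℝ) ^ 2 := by exact_mod_cast hu₂
  have hu₀0r : (0 : ℝ) ≤ (u₀ : ℝ) := by exact_mod_cast hu₀0
  have hu₂0r : (0 : ℝ) ≤ (u₂ : ℝ) := by exact_mod_cast hu₂0
  have hSfar' : (0 : ℝ) ≤ (rs.Sfar : ℝ) := by exact_mod_cast hSfar
  have hS : (0 : ℝ) ≤ (rs.Sfar : ℝ) + (10 : ℝ)⁻¹ ^ 29 := by positivity
  obtain ⟨hg0lo, hg2lo⟩ := hgaps_of_farGapCert (M := M) c.toSunsetCellRecordV2 rlo hrlo hβpos hμlo hμhi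
  have hg0mid := fun (i : MatsubaraIdx M) (h1 : (rlo.ω₁ : ℝ) ≤ |matsubaraFreq β M i|) (h2 : |matsubaraFreq β M i| < rmid.ω₁) =>
    (hrmid μ hμlo hμhi _ (matsubaraFreq_ne_zero' hβpos i) h1 h2).1
  have hg2mid := fun (i : MatsubaraIdx M) (h1 : (rlo.ω₁ : ℝ) ≤ |matsubaraFreq β M i|) (h2 : |matsubaraFreq β M i| < rmid.ω₁) =>
    (hrmid μ hμlo hμhi _ (matsubaraFreq_ne_zero' hβpos i) h1 h2).2
  refine sunsetRows_of_certV3_farSup3 (L := L) c hc hμ hμlo hμhi hβ hU0 hU hL3 hM3 hRcL hTmax' hrow' hω₀r hω₁r rs hrs hSfar'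
    hg0lo hg2lo hg0mid hg2mid (bS := bS) fun k => ?_
  have hfar := farBudget3_le_rational_farSup hω₁r hω₁r' (Rc := c.Rc) hωRcr hω₀r.le hG₂lor hs₀r hs₂r hs₀0r hs₂0r hG₂midr hu₀r hu₂r hu₀0r hu₂0r hS k
  exact le_trans (add_le_add le_rfl hfar) (hbS k)

end Summit.HubbardSuperconductivity.HubbardSuperconductivity.Theorems.KLRegimeSplit

end
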